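/-
Copyright: statement-level skeleton of a published paper (lit-balaban cell, Phase-2 proof seat p25, gen 17). No proof
claims beyond what the kernel checks below.
-/
import Literature.MathematicalPhysics.QuantumFieldTheory.BalabanImbrieJaffe1984to88.BIJ88LabelledRemainderCount312
import Literature.MathematicalPhysics.QuantumFieldTheory.BalabanImbrieJaffe1984to88.BIJ88VertexComponentsFieldLaw312

/-!
# `BalabanImbrieJaffe1984to88.BIJ88LabelledCoefBound312` — T. Bałaban, J. Imbrie, A. Jaffe, *Effective action and cluster
properties of the abelian Higgs model*, Commun. Math. Phys. **114** (1988) 257–315 [BalabanImbrieJaffe1988], §5.14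
p. 311–312 [PDF 55–56]: p. 311 *"The components containing contractions to χ′_{Λ(k)}, terms from the random walk
expansions, or at least m̄+1 interactions are called remainder components {X_r}."*; p. 312 *"By performing sufficiently
many integrations by parts, we have arranged for enough small factors to beat these large factors in the remainder
terms (at least if X_{r′} is not at the boundary of Λ(k))."* — **THE SMALL FACTORS OF THE LABELLED COMPONENT
EXPANSION, TERM BY TERM AND REMAINDER COMPONENT BY REMAINDER COMPONENT.**  p25 gen 16 built the labelled expansion
`expand` (blocks `X_c`, remainder components `X_r` set aside; `BIJ88LabelledExpansion311`), resummed it into print's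
first p. 312 display (`BIJ88Resummation312Display`) and COUNTED the small-factor sources of every term per remainder
component (`BIJ88LabelledRemainderCount312.remainder_components_count`).  This file supplies the ANALYTIC half in the
same currency: (1) along the run of one component every contraction weight is a covariance bracket `⟨A⁻¹u, v⟩` between
directions of a fixed set `Dir` (legs of observables and of vertices) or `⟨A⁻¹u, ℱ⟩`, each absorbed by one unit of the
termination potential `rpot`, and every vertex differentiated down contributes one coupling constant — so
`|a_o|·(max B 1)^{rpot(end)} ≤ (max B 1)^{rpot(start)}·c_M^{dv_o}` (`run_coef_bound`); (2) a potential
`Σ_{done}|pending legs| + Σ_{j ∈ rest}(|obs j| + 1 + M·maxArity)` telescopes along `expand`, whence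
`|coef_t| ≤ (max B 1)^{Σ_{j∈K}(|obs j|+1+M·maxArity)} · c_M^{nv_t}` for every term of `expand 0 K` (`expand_coef_bound`,
`expand_coef_bound_init`) and, with the count, `… · c_M^{M·#{X_r : M ≤ nv}}` — ONE FACTOR `c_M^{M}` PER VERTEX-SATURATED
REMAINDER COMPONENT (`expand_coef_bound_sat`); (3) the integral left in a term with a `χ′`-component carries the
Cauchy–Schwarz shell factor `√μ(Sh)` (`abs_gintM_le_shell`, gen 15's `abs_gint_le_shell` for leg multisets); (4) both
together: `remainder_term_bound` — for every term `t` of `expand 0 K`,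
`|tval [] t| ≤ (max B 1)^{Φ₀(K)} · c_M^{M·#sat(t)} · |∫Π_{legs of t's X_r}Φ·(Π_{dirs t}∂)χ·e^{−V}dμ_{C,ℱ}|`, the last
factor `≤ √(moment)·K_{dirs t}·√μ(Sh)` as soon as one `X_r` of `t` met `χ′`, and `#X_r(t) ≤ #χ′(t) + #sat(t)`.

statement-level skeleton of published theorems with citation tags; proofs where landed; nothing here is a claim
about the Yang–Mills mass gap

PDF held: `paper:balaban1988-cmp114-bij-abelian-higgs-effective-action` (journal page = PDF page + 256); p. 311–312 =
PDF 55–56 (`p0055.txt` L30–38, `p0056.txt` L20–25 re-read this session; the two quoted sentences are p0055 L35–37 and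
p0056 L23–25 verbatim up to the OCR of the sub/superscripts).

CITATION HEADER (lean-in-tree rule).  lit-balaban cell (HOME `run/shared/lean/pub/lit-balaban/`), Phase 2, seat p25
gen 17; row **C2.Claim@312** of `HOME/lit-balaban-r16/ROWS-C2-part2.md` (owner r16, referee ref-5; head
`BIJ88Sect5StatementsPart4.Ineq312` NOT touched — a MEMBER next to `BIJ88LabelledRemainderCount312`).  USED BY NAME,
nothing restated: `BIJ88LabelledRun311` (`run`, `rpot`, `rpot_pair/_pristine/_absorb/_drop/_vertex`, `Outcome`,
`LGrp.absorb`, `pristine`), `BIJ88LabelledRunEnv311` (`run_ind'`, `run_rest_subset`), `BIJ88LabelledExpansion311`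
(`expand`, `expand_of_(not_)nonempty`, `RTerm`, `oact`, `gintM`, `gintM_coe`, `tval`), `BIJ88LabelledRemainderCount312`
(`remainder_components_count`), `BIJ88VertexComponents311` (`maxArity`, `Grp.nv_lt_of_not_complete`),
`BIJ88VertexComponentsFieldLaw312.abs_gint_le_shell` (p25 gen 15), `BIJ88VertexIbp311.{lmono, vexp}`,
`BIJ88WickDerivatives305.dlist`, `B2Eq228Conditioning.{weight, source}`.

## What is proved (0 `sorry`, standard axioms, no definitions, no `Prop` facts)

* §1 **`run_dir`** — along a run the pending legs of the running component and of the set-aside components stay in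
  any set `Dir` containing the initial pending legs, all observables' legs and all vertex legs.
* §2 **`run_coef_bound`** — `|a_o| · (max B 1)^{rpot o} ≤ (max B 1)^{rpot g rest done} · c_M^{dv_o}` for every outcome
  `o` of `run g rest done` (brackets on `Dir` bounded by `B`, `|c_m| ≤ c_M`, `0 ≤ c_M`).
* §3 **`expand_coef_bound`** (the telescoping potential along `expand`), **`expand_coef_bound_init`**,
  **`expand_coef_bound_sat`** (`c_M ≤ 1`: one `c_M^{M}` per vertex-saturated remainder component).
* §4 **`abs_gintM_le_shell`**, `dirs_ne_nil_of_card_pos`, **`remainder_term_bound`** (the estimate of a term of the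
  resummed display, per remainder component, as above; the two kinds exhaust the remainder components, recalled).
(Helpers: `abs_bracket_getD_le`; private arithmetic `step_le`, `telescope_le`, `combine_le`, `sum_obs_split`.)
HONEST SCOPE: as in the gen 15/16 siblings — CONTRACTION-GRAPH components with ONE covariance of unrestricted range (no
`C → C_loc` split, no random-walk trigger, no geometry: `B` is a uniform bound on the brackets, not a decaying one, and
the potential exponent `Φ₀(K)` is the crude count of all possible contraction weights); the `χ′` small factor is ONE
global shell factor `√μ(Sh)` per term (not one per `χ′`-component; the cube-by-cube refinement is gen 15's
`BIJ88VertexChiCubes312`, whose `√μ(⋂Sh_b)` is itself not factorised); `K_D`, the Gaussian moments and `μ(Sh)` are not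
estimated here; the number of terms of `expand 0 K` is not estimated (so no bound on the SUMS `remv`, `F_{k,rem}`).
CURRENCY: feeds none of `BIJ88Sect5StatementsPart4.Ineq312` / `hobs` / `RemainderComponent` by name — the p. 312
estimate *"with appropriate bounds"* (decay in `|X_r|`) stays the row's open head question.  NOT summit progress; NOT
continuum; NOT Clay.  Imports `BIJ88LabelledRemainderCount312`, `BIJ88VertexComponentsFieldLaw312`; modifies nothing.
-/

noncomputable section

namespace Literature.MathematicalPhysics.QuantumFieldTheory.BalabanImbrieJaffe1984to88.BIJ88LabelledCoefBound312

open Classical MeasureTheory Matrix Finset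
open scoped BigOperators ContDiff
open Literature.MathematicalPhysics.QuantumFieldTheory.Balaban1983to89
open B2Eq228Conditioning (weight source)
open BIJ88VertexIbp311 (lmono vexp lmono_append)
open BIJ88WickDerivatives305 (dlist)
open BIJ88VertexComponents311 (Grp maxArity)
open BIJ88VertexComponentsExpansion311 (gint)
open BIJ88VertexComponentsFieldLaw312 (abs_gint_le_shell)
open BIJ88LabelledRun311 BIJ88LabelledRunEnv311 BIJ88LabelledExpansion311 BIJ88LabelledRemainderCount312

variable {S : Type} [Fintype S] [DecidableEq S] {ι : Type} [Fintype ι] {κ : Type}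

/-! ## §1  Directions stay in `Dir` along a run -/

section Run

variable [DecidableEq κ]
variable {A : Matrix S S ℝ} {f : S → ℝ} {c : ι → ℝ} {legs : ι → List (S → ℝ)} {obs : κ → List (S → ℝ)} {M : ℕ}
  {Dir : Set (S → ℝ)}

/-- **The pending legs in play stay inside `Dir`**: if `Dir` contains the pending legs of the running component and of
the set-aside components, every observable's legs and every vertex leg, then it contains the pending legs of every
outcome's component and set-aside components (contractions only remove legs; joining a pristine observable, a
set-aside component or a vertex only adds legs from `Dir`). [cite: BalabanImbrieJaffe1988, §5.14 p.311] -/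
theorem run_dir (hobs : ∀ j, ∀ w ∈ obs j, w ∈ Dir) (hlegs : ∀ m, ∀ w ∈ legs m, w ∈ Dir)
    (g : LGrp S κ) (rest : Finset κ) (done : Multiset (LGrp S κ)) :
    ∀ o ∈ run A f c legs obs M g rest done, (∀ w ∈ g.pend, w ∈ Dir) → (∀ h ∈ done, ∀ w ∈ h.pend, w ∈ Dir) →
      (∀ w ∈ o.g.pend, w ∈ Dir) ∧ ∀ h ∈ o.done, ∀ w ∈ h.pend, w ∈ Dir := by
  refine run_ind' (P := fun g _ done o => (∀ w ∈ g.pend, w ∈ Dir) → (∀ h ∈ done, ∀ w ∈ h.pend, w ∈ Dir) →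
      (∀ w ∈ o.g.pend, w ∈ Dir) ∧ ∀ h ∈ o.done, ∀ w ∈ h.pend, w ∈ Dir)
    (fun _ _ _ _ hg hd => ⟨hg, hd⟩) ?_ ?_ ?_ ?_ ?_ ?_ g rest done
  · intro g rest done u L _ hp i o _ h hg hd
    rw [Outcome.scale_g, Outcome.scale_done]
    exact h (fun w hw => hg w (by rw [hp]; exact List.mem_cons_of_mem u (List.mem_of_mem_eraseIdx hw))) hd
  · intro g rest done u L _ hp j _ i o _ h hg hd
    rw [Outcome.scale_g, Outcome.scale_done]
    refine h (fun w hw => ?_) hd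
    rcases List.mem_append.1 hw with hw | hw
    · exact hg w (by rw [hp]; exact List.mem_cons_of_mem u hw)
    · exact hobs j w (List.mem_of_mem_eraseIdx hw)
  · intro g rest done u L _ hp h hh i _ o _ h' hg hd
    rw [Outcome.scale_g, Outcome.scale_done]
    refine h' (fun w hw => ?_) (fun h' hh' => hd h' (Multiset.mem_of_mem_erase hh'))
    simp only [LGrp.absorb] at hw
    rcases List.mem_append.1 hw with hw | hw
    · exact hg w (by rw [hp]; exact List.mem_cons_of_mem u hw)
    · exact hd h hh w (List.mem_of_mem_eraseIdx hw)
  · intro g rest done u L _ hp o _ h hg hd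
    rw [Outcome.scale_g, Outcome.scale_done]
    exact h (fun w hw => hg w (by rw [hp]; exact List.mem_cons_of_mem u hw)) hd
  · intro g rest done u L _ hp o _ h hg hd
    rw [Outcome.push_g, Outcome.push_done]
    exact h (fun w hw => hg w (by rw [hp]; exact List.mem_cons_of_mem u hw)) hd
  · intro g rest done u L _ hp m j o _ h hg hd
    rw [Outcome.bump_g, Outcome.bump_done, Outcome.scale_g, Outcome.scale_done]
    refine h (fun w hw => ?_) hd
    rcases List.mem_append.1 hw with hw | hw
    · exact hg w (by rw [hp]; exact List.mem_cons_of_mem u hw)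
    · exact hlegs m w (List.mem_of_mem_eraseIdx hw)

/-! ## §2  The coefficient of an outcome: brackets against the potential, couplings against the vertices -/

omit [Fintype ι] [DecidableEq κ] in
/-- A bracket of a direction of `Dir` against a default access into a list of directions of `Dir` is at most
`max B 1` (out of range the access is `0`). [folklore] [cite: BalabanImbrieJaffe1988, §5.14 p.312] -/
theorem abs_bracket_getD_le {B : ℝ} (hB : ∀ u ∈ Dir, ∀ v ∈ Dir, |(A⁻¹ *ᵥ u) ⬝ᵥ v| ≤ B) {u : S → ℝ} (hu : u ∈ Dir)
    {L : List (S → ℝ)} (hL : ∀ w ∈ L, w ∈ Dir) (i : ℕ) : |(A⁻¹ *ᵥ u) ⬝ᵥ L.getD i 0| ≤ max B 1 := by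
  by_cases hi : i < L.length
  · rw [List.getD_eq_getElem _ _ hi]
    exact (hB u hu _ (hL _ (List.getElem_mem hi))).trans (le_max_left _ _)
  · rw [List.getD_eq_default _ _ (not_lt.1 hi), dotProduct_zero, abs_zero]
    exact zero_le_one.trans (le_max_right _ _)

omit [Fintype S] [DecidableEq S] [Fintype ι] [DecidableEq κ] in
/-- One contraction weight is absorbed by one unit of potential: from `|w| ≤ m`, `1 ≤ m`,
`x·m^r ≤ m^{N'}·y` and `N' < N` follows `|w|·x·m^r ≤ m^N·y`. [folklore] -/
private theorem step_le {w x y m : ℝ} {r N' N : ℕ} (hw : |w| ≤ m) (hm : 1 ≤ m) (hy : 0 ≤ y)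
    (hx : x * m ^ r ≤ m ^ N' * y) (hx0 : 0 ≤ x) (hN : N' < N) : |w| * x * m ^ r ≤ m ^ N * y := by
  have h0 : 0 ≤ m := zero_le_one.trans hm
  calc |w| * x * m ^ r = |w| * (x * m ^ r) := by ring
    _ ≤ m * (m ^ N' * y) := mul_le_mul hw hx (mul_nonneg hx0 (pow_nonneg h0 _)) h0
    _ = m ^ (N' + 1) * y := by ring
    _ ≤ m ^ N * y := mul_le_mul_of_nonneg_right (pow_le_pow_right₀ hm (Nat.succ_le_of_lt hN)) hy

/-- **EACH CONTRACTION WEIGHT IS PAID BY THE POTENTIAL, EACH VERTEX BY A COUPLING CONSTANT** (p. 312 *"… we have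
arranged for enough small factors … in the remainder terms"*, the bookkeeping behind it): if every bracket
`⟨A⁻¹u, v⟩`, `u, v ∈ Dir`, and `⟨A⁻¹u, ℱ⟩`, `u ∈ Dir`, is bounded by `B`, every coupling by `|c_m| ≤ c_M` with `0 ≤ c_M`,
and `Dir` contains all legs in play, then for every outcome `o` of `run g rest done`:
`|a_o| · (max B 1)^{rpot o.g o.rest o.done} ≤ (max B 1)^{rpot g rest done} · c_M^{dv_o}` — every one of the six
events lowers `rpot` by at least one and multiplies the weight by at most one bracket (and one coupling, for a vertex).
[cite: BalabanImbrieJaffe1988, §5.14 p.312] -/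
theorem run_coef_bound {B cM : ℝ} (hB : ∀ u ∈ Dir, ∀ v ∈ Dir, |(A⁻¹ *ᵥ u) ⬝ᵥ v| ≤ B)
    (hBf : ∀ u ∈ Dir, |(A⁻¹ *ᵥ u) ⬝ᵥ f| ≤ B) (hcM : 0 ≤ cM) (hcm : ∀ m, |c m| ≤ cM)
    (hobs : ∀ j, ∀ w ∈ obs j, w ∈ Dir) (hlegs : ∀ m, ∀ w ∈ legs m, w ∈ Dir)
    (g : LGrp S κ) (rest : Finset κ) (done : Multiset (LGrp S κ)) :
    ∀ o ∈ run A f c legs obs M g rest done, (∀ w ∈ g.pend, w ∈ Dir) → (∀ h ∈ done, ∀ w ∈ h.pend, w ∈ Dir) →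
      |o.a| * (max B 1) ^ rpot obs M (maxArity legs) o.g o.rest o.done
        ≤ (max B 1) ^ rpot obs M (maxArity legs) g rest done * cM ^ o.dv := by
  have hm : 1 ≤ max B 1 := le_max_right B 1
  have hBm : B ≤ max B 1 := le_max_left B 1
  refine run_ind' (P := fun g rest done o => (∀ w ∈ g.pend, w ∈ Dir) → (∀ h ∈ done, ∀ w ∈ h.pend, w ∈ Dir) →
      |o.a| * (max B 1) ^ rpot obs M (maxArity legs) o.g o.rest o.done
        ≤ (max B 1) ^ rpot obs M (maxArity legs) g rest done * cM ^ o.dv) ?_ ?_ ?_ ?_ ?_ ?_ ?_ g rest done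
  · intro g rest done _ _ _
    simp only [abs_one, one_mul, pow_zero, mul_one, le_refl]
  · -- (1) a contraction inside the component
    intro g rest done u L _ hp i o _ h hg hd
    have hu : u ∈ Dir := hg u (by rw [hp]; exact List.mem_cons_self)
    have hL : ∀ w ∈ L, w ∈ Dir := fun w hw => hg w (by rw [hp]; exact List.mem_cons_of_mem u hw)
    have ih := h (fun w hw => hL w (List.mem_of_mem_eraseIdx hw)) hd
    simp only [Outcome.scale_a, Outcome.scale_g, Outcome.scale_rest, Outcome.scale_done, Outcome.scale_dv, abs_mul]
    exact step_le (abs_bracket_getD_le hB hu hL i) hm (pow_nonneg hcM _) ih (abs_nonneg _)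
      (rpot_pair obs M _ rest done hp i)
  · -- (2) a pristine observable joins
    intro g rest done u L _ hp j hj i o _ h hg hd
    have hu : u ∈ Dir := hg u (by rw [hp]; exact List.mem_cons_self)
    have hL : ∀ w ∈ L, w ∈ Dir := fun w hw => hg w (by rw [hp]; exact List.mem_cons_of_mem u hw)
    have ih := h (fun w hw => by
      rcases List.mem_append.1 hw with hw | hw
      · exact hL w hw
      · exact hobs j w (List.mem_of_mem_eraseIdx hw)) hd
    simp only [Outcome.scale_a, Outcome.scale_g, Outcome.scale_rest, Outcome.scale_done, Outcome.scale_dv, abs_mul]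
    exact step_le (abs_bracket_getD_le hB hu (hobs j) i) hm (pow_nonneg hcM _) ih (abs_nonneg _)
      (rpot_pristine obs M _ rest done hp hj i _)
  · -- (3) a complete component set aside joins
    intro g rest done u L _ hp h hh i _ o _ h' hg hd
    have hu : u ∈ Dir := hg u (by rw [hp]; exact List.mem_cons_self)
    have hL : ∀ w ∈ L, w ∈ Dir := fun w hw => hg w (by rw [hp]; exact List.mem_cons_of_mem u hw)
    have ih := h' (fun w hw => by
      simp only [LGrp.absorb] at hw
      rcases List.mem_append.1 hw with hw | hw
      · exact hL w hw
      · exact hd h hh w (List.mem_of_mem_eraseIdx hw)) (fun h' hh' => hd h' (Multiset.mem_of_mem_erase hh'))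
    simp only [Outcome.scale_a, Outcome.scale_g, Outcome.scale_rest, Outcome.scale_done, Outcome.scale_dv, abs_mul]
    exact step_le (abs_bracket_getD_le hB hu (hd h hh) i) hm (pow_nonneg hcM _) ih (abs_nonneg _)
      (rpot_absorb obs M _ rest done hp hh i)
  · -- (4) the source
    intro g rest done u L _ hp o _ h hg hd
    have hu : u ∈ Dir := hg u (by rw [hp]; exact List.mem_cons_self)
    have hL : ∀ w ∈ L, w ∈ Dir := fun w hw => hg w (by rw [hp]; exact List.mem_cons_of_mem u hw)
    have ih := h hL hd
    simp only [Outcome.scale_a, Outcome.scale_g, Outcome.scale_rest, Outcome.scale_done, Outcome.scale_dv, abs_mul]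
    exact step_le ((hBf u hu).trans hBm) hm (pow_nonneg hcM _) ih (abs_nonneg _) (rpot_drop obs M _ rest done hp _)
  · -- (5) χ′: no weight, the potential still drops
    intro g rest done u L _ hp o _ h hg hd
    have hL : ∀ w ∈ L, w ∈ Dir := fun w hw => hg w (by rw [hp]; exact List.mem_cons_of_mem u hw)
    have ih := h hL hd
    simp only [Outcome.push_a, Outcome.push_g, Outcome.push_rest, Outcome.push_done, Outcome.push_dv]
    exact ih.trans (mul_le_mul_of_nonneg_right (pow_le_pow_right₀ hm (rpot_drop obs M _ rest done hp _).le)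
      (pow_nonneg hcM _))
  · -- (6) a vertex: one bracket and one coupling constant
    intro g rest done u L hc hp m j o _ h hg hd
    have hnv : g.nv < M := Grp.nv_lt_of_not_complete hc
    have hu : u ∈ Dir := hg u (by rw [hp]; exact List.mem_cons_self)
    have hL : ∀ w ∈ L, w ∈ Dir := fun w hw => hg w (by rw [hp]; exact List.mem_cons_of_mem u hw)
    have ih := h (fun w hw => by
      rcases List.mem_append.1 hw with hw | hw
      · exact hL w hw
      · exact hlegs m w (List.mem_of_mem_eraseIdx hw)) hd
    simp only [Outcome.bump_a, Outcome.bump_g, Outcome.bump_rest, Outcome.bump_done, Outcome.bump_dv, Outcome.scale_a,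
      Outcome.scale_g, Outcome.scale_rest, Outcome.scale_done, Outcome.scale_dv, neg_mul, abs_neg, abs_mul, pow_succ]
    have hs := step_le (abs_bracket_getD_le hB hu (hlegs m) j) hm (pow_nonneg hcM _) ih (abs_nonneg _)
      (rpot_vertex obs M rest done legs hp hnv m j)
    have h0 : 0 ≤ |(A⁻¹ *ᵥ u) ⬝ᵥ (legs m).getD j 0| * |o.a| * (max B 1) ^ rpot obs M (maxArity legs) o.g o.rest o.done :=
      mul_nonneg (mul_nonneg (abs_nonneg _) (abs_nonneg _)) (pow_nonneg (zero_le_one.trans hm) _)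
    calc |c m| * |(A⁻¹ *ᵥ u) ⬝ᵥ (legs m).getD j 0| * |o.a| * (max B 1) ^ rpot obs M (maxArity legs) o.g o.rest o.done
        = |c m| * (|(A⁻¹ *ᵥ u) ⬝ᵥ (legs m).getD j 0| * |o.a|
            * (max B 1) ^ rpot obs M (maxArity legs) o.g o.rest o.done) := by ring
      _ ≤ cM * ((max B 1) ^ rpot obs M (maxArity legs) g rest done * cM ^ o.dv) := mul_le_mul (hcm m) hs h0 hcM
      _ = (max B 1) ^ rpot obs M (maxArity legs) g rest done * (cM ^ o.dv * cM) := by ring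

end Run

/-! ## §3  The telescoping potential along the expansion -/

section Expand

variable [LinearOrder κ]
variable {A : Matrix S S ℝ} {f : S → ℝ} {c : ι → ℝ} {legs : ι → List (S → ℝ)} {obs : κ → List (S → ℝ)} {M : ℕ}
  {Dir : Set (S → ℝ)} {B cM : ℝ}

omit [Fintype S] [DecidableEq S] [Fintype ι] [LinearOrder κ] in
/-- The potential bookkeeping of one run inside the expansion (ℕ arithmetic): with `Vo ≤ Vr` (the untouched
observables only decrease) and `extra ≤ lo`, `(start) + (next) ≤ (now) + (end)`. [folklore] -/
private theorem telescope_le {li P Ur Ud Vr lo Q Uo Udo Vo extra : ℕ} (hV : Vo ≤ Vr) (hx : extra ≤ lo) :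
    (li + 1 + P + Ur + Ud) + (extra + Udo + (Uo + Vo)) ≤ (Ud + (li + 1 + P + (Ur + Vr))) + (lo + 1 + Q + Uo + Udo) := by
  omega

omit [Fintype S] [DecidableEq S] [Fintype ι] [LinearOrder κ] in
/-- Combining the bound of a run with the bound of the rest of the expansion (real arithmetic): the potential released
by the run pays for its brackets. [folklore] -/
private theorem combine_le {a t m cv cn : ℝ} {Rs Re Φ Φn : ℕ} (hm : 1 ≤ m) (hcv : 0 ≤ cv) (hcn : 0 ≤ cn)
    (hrun : |a| * m ^ Re ≤ m ^ Rs * cv) (ih : |t| ≤ m ^ Φn * cn) (key : Rs + Φn ≤ Φ + Re) :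
    |a * t| ≤ m ^ Φ * (cv * cn) := by
  have hm0 : 0 < m := zero_lt_one.trans_le hm
  refine le_of_mul_le_mul_right ?_ (pow_pos hm0 Re)
  rw [abs_mul]
  calc |a| * |t| * m ^ Re = (|a| * m ^ Re) * |t| := by ring
    _ ≤ (m ^ Rs * cv) * (m ^ Φn * cn) :=
        mul_le_mul hrun ih (abs_nonneg _) (mul_nonneg (pow_nonneg hm0.le _) hcv)
    _ = m ^ (Rs + Φn) * (cv * cn) := by rw [pow_add]; ring
    _ ≤ m ^ (Φ + Re) * (cv * cn) := mul_le_mul_of_nonneg_right (pow_le_pow_right₀ hm key) (mul_nonneg hcv hcn)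
    _ = m ^ Φ * (cv * cn) * m ^ Re := by rw [pow_add]; ring

omit [Fintype S] [DecidableEq S] [Fintype ι] [LinearOrder κ] in
/-- Splitting the observable part of the potential: `Σ_{j∈s}(|obs j| + 1 + M·A) = Σ_{j∈s}|obs j| + Σ_{j∈s}(1 + M·A)`.
[folklore] -/
private theorem sum_obs_split (obs : κ → List (S → ℝ)) (M Am : ℕ) (s : Finset κ) :
    ∑ j ∈ s, ((obs j).length + 1 + M * Am) = ∑ j ∈ s, (obs j).length + ∑ _j ∈ s, (1 + M * Am) := by
  rw [← Finset.sum_add_distrib]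
  exact Finset.sum_congr rfl fun _ _ => add_assoc _ _ _

/-- **THE COEFFICIENTS OF THE LABELLED EXPANSION** (p. 312): with brackets on `Dir` bounded by `B`, couplings by
`c_M ≥ 0`, and `Dir` containing every observable's legs, every vertex leg and the pending legs of the complete
components `done` set aside, every term `t` of `expand done rest` has
`|coef_t| ≤ (max B 1)^{Σ_{h∈done}|pend h| + Σ_{j∈rest}(|obs j| + 1 + M·maxArity)} · c_M^{nv_t}` — the exponent is a
potential that telescopes along the expansion: the run of the least observable releases at least as much `rpot` as it
uses brackets (`run_coef_bound`), and what it leaves (its component's pending legs if set aside, the untouched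
observables, the untouched complete components) is at most the potential of the next state.
[cite: BalabanImbrieJaffe1988, §5.14 p.312] -/
theorem expand_coef_bound (hB : ∀ u ∈ Dir, ∀ v ∈ Dir, |(A⁻¹ *ᵥ u) ⬝ᵥ v| ≤ B)
    (hBf : ∀ u ∈ Dir, |(A⁻¹ *ᵥ u) ⬝ᵥ f| ≤ B) (hcM : 0 ≤ cM) (hcm : ∀ m, |c m| ≤ cM)
    (hobs : ∀ j, ∀ w ∈ obs j, w ∈ Dir) (hlegs : ∀ m, ∀ w ∈ legs m, w ∈ Dir) :
    ∀ (n : ℕ) (done : Multiset (LGrp S κ)) (rest : Finset κ), rest.card < n →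
      (∀ h ∈ done, ∀ w ∈ h.pend, w ∈ Dir) → ∀ t ∈ expand A f c legs obs M done rest,
        |t.coef| ≤ (max B 1) ^ ((done.map fun h => h.pend.length).sum
          + ∑ j ∈ rest, ((obs j).length + 1 + M * maxArity legs)) * cM ^ t.nv
  | 0, _, _, hn => fun _ _ _ => absurd hn (Nat.not_lt_zero _)
  | n + 1, done, rest, hn => by
    intro hd t ht
    have hm : 1 ≤ max B 1 := le_max_right B 1
    by_cases h : rest.Nonempty
    · rw [expand_of_nonempty A f c legs obs M h, mem_mbind] at ht
      obtain ⟨o, ho, ht⟩ := ht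
      have hi := rest.min'_mem h
      have hcard : o.rest.card < n := lt_of_lt_of_le (lt_of_le_of_lt (Finset.card_le_card (run_rest_subset _ _ _ o ho))
        (Finset.card_erase_lt_of_mem hi)) (Nat.lt_succ_iff.1 hn)
      have hpr : ∀ w ∈ (pristine obs (rest.min' h)).pend, w ∈ Dir := hobs _
      obtain ⟨hog, hod⟩ := run_dir hobs hlegs _ _ _ o ho hpr hd
      have hrun := run_coef_bound hB hBf hcM hcm hobs hlegs _ _ _ o ho hpr hd
      -- the potential bookkeeping of this run
      have hV : ∑ _j ∈ o.rest, (1 + M * maxArity legs) ≤ ∑ _j ∈ rest.erase (rest.min' h), (1 + M * maxArity legs) :=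
        Finset.sum_le_sum_of_subset (run_rest_subset _ _ _ o ho)
      have hsplit := (Finset.add_sum_erase rest (fun j => (obs j).length + 1 + M * maxArity legs) hi).symm
      have e_start : rpot obs M (maxArity legs) (pristine obs (rest.min' h)) (rest.erase (rest.min' h)) done
          = (obs (rest.min' h)).length + 1 + M * maxArity legs + ∑ j ∈ rest.erase (rest.min' h), (obs j).length
            + (done.map fun h => h.pend.length).sum := by
        simp only [rpot, pristine, Nat.sub_zero]
      have e_end : rpot obs M (maxArity legs) o.g o.rest o.done = o.g.pend.length + 1 + (M - o.g.nv) * maxArity legs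
          + ∑ j ∈ o.rest, (obs j).length + (o.done.map fun h => h.pend.length).sum := rfl
      split_ifs at ht with hg
      · -- a constant component, booked as a block
        rw [Multiset.mem_map] at ht
        obtain ⟨t', ht', rfl⟩ := ht
        have ih := expand_coef_bound hB hBf hcM hcm hobs hlegs n o.done o.rest hcard hod t' ht'
        have key : rpot obs M (maxArity legs) (pristine obs (rest.min' h)) (rest.erase (rest.min' h)) done
            + ((o.done.map fun h => h.pend.length).sum + ∑ j ∈ o.rest, ((obs j).length + 1 + M * maxArity legs))
            ≤ ((done.map fun h => h.pend.length).sum + ∑ j ∈ rest, ((obs j).length + 1 + M * maxArity legs))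
              + rpot obs M (maxArity legs) o.g o.rest o.done := by
          rw [e_start, e_end, hsplit, sum_obs_split obs M (maxArity legs) (rest.erase _),
            sum_obs_split obs M (maxArity legs) o.rest]
          have := telescope_le (li := (obs (rest.min' h)).length) (P := M * maxArity legs)
            (Ur := ∑ j ∈ rest.erase (rest.min' h), (obs j).length) (Ud := (done.map fun h => h.pend.length).sum)
            (lo := o.g.pend.length) (Q := (M - o.g.nv) * maxArity legs) (Uo := ∑ j ∈ o.rest, (obs j).length)
            (Udo := (o.done.map fun h => h.pend.length).sum) (extra := 0) hV (Nat.zero_le _)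
          omega
        rw [RTerm.addConst_coef, oact_coef, RTerm.addConst_nv, oact_nv, pow_add cM]
        exact combine_le hm (pow_nonneg hcM _) (pow_nonneg hcM _) hrun ih key
      · -- a remainder component, set aside
        rw [Multiset.mem_map] at ht
        obtain ⟨t', ht', rfl⟩ := ht
        have hod' : ∀ h ∈ o.g ::ₘ o.done, ∀ w ∈ h.pend, w ∈ Dir := fun h hh => by
          rcases Multiset.mem_cons.1 hh with rfl | hh
          · exact hog
          · exact hod h hh
        have ih := expand_coef_bound hB hBf hcM hcm hobs hlegs n (o.g ::ₘ o.done) o.rest hcard hod' t' ht'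
        have key : rpot obs M (maxArity legs) (pristine obs (rest.min' h)) (rest.erase (rest.min' h)) done
            + (((o.g ::ₘ o.done).map fun h => h.pend.length).sum
              + ∑ j ∈ o.rest, ((obs j).length + 1 + M * maxArity legs))
            ≤ ((done.map fun h => h.pend.length).sum + ∑ j ∈ rest, ((obs j).length + 1 + M * maxArity legs))
              + rpot obs M (maxArity legs) o.g o.rest o.done := by
          rw [Multiset.map_cons, Multiset.sum_cons, e_start, e_end, hsplit,
            sum_obs_split obs M (maxArity legs) (rest.erase _), sum_obs_split obs M (maxArity legs) o.rest]
          have := telescope_le (li := (obs (rest.min' h)).length) (P := M * maxArity legs)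
            (Ur := ∑ j ∈ rest.erase (rest.min' h), (obs j).length) (Ud := (done.map fun h => h.pend.length).sum)
            (lo := o.g.pend.length) (Q := (M - o.g.nv) * maxArity legs) (Uo := ∑ j ∈ o.rest, (obs j).length)
            (Udo := (o.done.map fun h => h.pend.length).sum) (extra := o.g.pend.length) hV le_rfl
          omega
        rw [oact_coef, oact_nv, pow_add cM]
        exact combine_le hm (pow_nonneg hcM _) (pow_nonneg hcM _) hrun ih key
    · rw [expand_of_not_nonempty A f c legs obs M h, Multiset.mem_singleton] at ht
      subst ht
      simp only [abs_one, pow_zero, mul_one]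
      exact one_le_pow₀ hm

/-- **THE COEFFICIENTS OF THE EXPANSION OF A PRODUCT OF OBSERVABLES** `K` (nothing set aside):
`|coef_t| ≤ (max B 1)^{Σ_{j∈K}(|obs j| + 1 + M·maxArity)} · c_M^{nv_t}` — one coupling constant per vertex differentiated
down, the brackets paid by the crude count of all possible contraction weights. [cite: BalabanImbrieJaffe1988, §5.14 p.312] -/
theorem expand_coef_bound_init (hB : ∀ u ∈ Dir, ∀ v ∈ Dir, |(A⁻¹ *ᵥ u) ⬝ᵥ v| ≤ B)
    (hBf : ∀ u ∈ Dir, |(A⁻¹ *ᵥ u) ⬝ᵥ f| ≤ B) (hcM : 0 ≤ cM) (hcm : ∀ m, |c m| ≤ cM)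
    (hobs : ∀ j, ∀ w ∈ obs j, w ∈ Dir) (hlegs : ∀ m, ∀ w ∈ legs m, w ∈ Dir) (K : Finset κ) :
    ∀ t ∈ expand A f c legs obs M 0 K,
      |t.coef| ≤ (max B 1) ^ (∑ j ∈ K, ((obs j).length + 1 + M * maxArity legs)) * cM ^ t.nv := by
  intro t ht
  have h := expand_coef_bound hB hBf hcM hcm hobs hlegs _ 0 K (Nat.lt_succ_self _)
    (fun h hh => absurd hh (Multiset.notMem_zero _)) t ht
  rwa [Multiset.map_zero, Multiset.sum_zero, zero_add] at h

/-- **ONE FACTOR `c_M^{M}` PER VERTEX-SATURATED REMAINDER COMPONENT** (p. 311 *"… or at least m̄+1 interactions are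
called remainder components"*, p. 312 *"enough small factors"*): for `c_M ≤ 1`, every term of `expand 0 K` has
`|coef_t| ≤ (max B 1)^{Σ_{j∈K}(|obs j|+1+M·maxArity)} · c_M^{M · #{X_r ∈ t.groups : M ≤ nv(X_r)}}` — `M = m̄+1` vertices
OF ITS OWN in each such component (`remainder_components_count`). [cite: BalabanImbrieJaffe1988, §5.14 p.311–312] -/
theorem expand_coef_bound_sat (hB : ∀ u ∈ Dir, ∀ v ∈ Dir, |(A⁻¹ *ᵥ u) ⬝ᵥ v| ≤ B)
    (hBf : ∀ u ∈ Dir, |(A⁻¹ *ᵥ u) ⬝ᵥ f| ≤ B) (hcM : 0 ≤ cM) (hcM1 : cM ≤ 1) (hcm : ∀ m, |c m| ≤ cM)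
    (hobs : ∀ j, ∀ w ∈ obs j, w ∈ Dir) (hlegs : ∀ m, ∀ w ∈ legs m, w ∈ Dir) (K : Finset κ) :
    ∀ t ∈ expand A f c legs obs M 0 K,
      |t.coef| ≤ (max B 1) ^ (∑ j ∈ K, ((obs j).length + 1 + M * maxArity legs))
        * cM ^ (M * Multiset.card (t.groups.filter fun g => M ≤ g.nv)) := by
  intro t ht
  refine (expand_coef_bound_init hB hBf hcM hcm hobs hlegs K t ht).trans
    (mul_le_mul_of_nonneg_left (pow_le_pow_of_le_one hcM hcM1 ?_) (pow_nonneg (zero_le_one.trans (le_max_right _ _)) _))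
  exact (remainder_components_count (A := A) (f := f) (c := c) (legs := legs) (obs := obs) (M := M) K t ht).2.2.1

/-! ## §4  The integral of a term: the shell factor, and the estimate per remainder component -/

variable (A f c legs)

/-- **THE `χ′` SMALL FACTOR FOR A MULTISET OF LEGS** (gen 15's `abs_gint_le_shell`, Cauchy–Schwarz in `L²(dμ_{C,ℱ})`):
with at least one `χ′`-direction under the integral,
`|∫ Π_{w∈P}Φ(w)·(Π_D∂)χ·e^{−V} dμ_{C,ℱ}| ≤ √(∫ (Π_{w∈P}Φ(w))² dμ_{C,ℱ}) · K_D · √μ(Sh)`, `Sh` a closed set off which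
`χ′ = 0`. [cite: BalabanImbrieJaffe1988, §5.14 p.312] -/
theorem abs_gintM_le_shell (hA : A.PosDef) {χ : (S → ℝ) → ℝ} (hχ : ContDiff ℝ ∞ χ) {Kd : List (S → ℝ) → ℝ}
    (hK : ∀ D φ, |dlist D χ φ * vexp c legs φ| ≤ Kd D) {Sh : Set (S → ℝ)} (hSh : IsClosed Sh)
    (hχS : ∀ φ, φ ∉ Sh → fderiv ℝ χ φ = 0) (P : Multiset (S → ℝ)) {D : List (S → ℝ)} (hD : D ≠ []) :
    |gintM A f c legs χ P D|
      ≤ Real.sqrt (∫ φ : S → ℝ, (P.map fun w => φ ⬝ᵥ w).prod ^ 2 * (weight A φ * source f φ))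
        * (Kd D * Real.sqrt (∫ φ : S → ℝ, Sh.indicator (fun _ => (1 : ℝ)) φ * (weight A φ * source f φ))) := by
  induction P using Quot.ind with
  | mk L =>
    simp only [Multiset.quot_mk_to_coe'', gintM_coe]
    refine (abs_gint_le_shell hA f c legs hχ hK hSh hχS L hD).trans (le_of_eq ?_)
    congr 2
    refine integral_congr_ae (Filter.Eventually.of_forall fun φ => ?_)
    dsimp only
    rw [lmono_append]
    simp only [sq, lmono, Multiset.map_coe, Multiset.prod_coe]

variable {A f c legs}

omit [Fintype S] [DecidableEq S] [Fintype ι] [LinearOrder κ] in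
/-- A component with a `χ′` forces a `χ′`-direction under the term's integral (counted in
`remainder_components_count`). [cite: BalabanImbrieJaffe1988, §5.14 p.311–312] -/
theorem dirs_ne_nil_of_card_pos {t : RTerm S κ}
    (h : Multiset.card (t.groups.filter fun g => 0 < g.nchi) ≤ t.dirs.length)
    (hpos : 0 < Multiset.card (t.groups.filter fun g => 0 < g.nchi)) : t.dirs ≠ [] :=
  List.ne_nil_of_length_pos (lt_of_lt_of_le hpos h)

/-- **THE ESTIMATE OF A TERM OF THE RESUMMED DISPLAY, PER REMAINDER COMPONENT** (p. 312 *"By performing sufficiently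
many integrations by parts, we have arranged for enough small factors to beat these large factors in the remainder
terms"* — the analytic half, in the currency of `BIJ88Resummation312Display`/`BIJ88LabelledRemainderCount312`): for
every term `t` of the labelled expansion of the observables `K` (legs `obs`, interaction `V = Σ c_m Π_{legs m}Φ`, cutoff
`χ ∈ C^∞` with `χ′ = 0` off the closed shell `Sh`, Gaussian `dμ_{C,ℱ}` with `A = C⁻¹ ≻ 0`; brackets on `Dir ⊇` all legs
bounded by `B`, `|c_m| ≤ c_M ≤ 1`), writing `P_t` for the pending legs of its remainder components and
`#sat(t)`, `#χ′(t)` for the numbers of its remainder components with `≥ M` vertices, resp. with a contraction to `χ′`: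
(i) `|tval [] t| ≤ (max B 1)^{Σ_{j∈K}(|obs j|+1+M·maxArity)} · c_M^{M·#sat(t)} · |∫Π_{P_t}Φ·(Π_{dirs t}∂)χ·e^{−V}dμ|`;
(ii) if `#χ′(t) ≥ 1` the last integral is at most `√(∫(Π_{P_t}Φ)²dμ) · K_{dirs t} · √μ(Sh)`;
(iii) `#X_r(t) ≤ #χ′(t) + #sat(t)` — every remainder component is of one of the two kinds.
[cite: BalabanImbrieJaffe1988, §5.14 p.311–312] -/
theorem remainder_term_bound (hA : A.PosDef) {χ : (S → ℝ) → ℝ} (hχ : ContDiff ℝ ∞ χ) {Kd : List (S → ℝ) → ℝ}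
    (hK : ∀ D φ, |dlist D χ φ * vexp c legs φ| ≤ Kd D) {Sh : Set (S → ℝ)} (hSh : IsClosed Sh)
    (hχS : ∀ φ, φ ∉ Sh → fderiv ℝ χ φ = 0)
    (hB : ∀ u ∈ Dir, ∀ v ∈ Dir, |(A⁻¹ *ᵥ u) ⬝ᵥ v| ≤ B) (hBf : ∀ u ∈ Dir, |(A⁻¹ *ᵥ u) ⬝ᵥ f| ≤ B)
    (hcM : 0 ≤ cM) (hcM1 : cM ≤ 1) (hcm : ∀ m, |c m| ≤ cM)
    (hobs : ∀ j, ∀ w ∈ obs j, w ∈ Dir) (hlegs : ∀ m, ∀ w ∈ legs m, w ∈ Dir) (K : Finset κ) :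
    ∀ t ∈ expand A f c legs obs M 0 K,
      |tval A f c legs χ [] t|
          ≤ (max B 1) ^ (∑ j ∈ K, ((obs j).length + 1 + M * maxArity legs))
            * cM ^ (M * Multiset.card (t.groups.filter fun g => M ≤ g.nv))
            * |gintM A f c legs χ ((t.groups.map fun h => (h.pend : Multiset (S → ℝ))).sum) t.dirs|
      ∧ (0 < Multiset.card (t.groups.filter fun g => 0 < g.nchi) →
          |gintM A f c legs χ ((t.groups.map fun h => (h.pend : Multiset (S → ℝ))).sum) t.dirs|
            ≤ Real.sqrt (∫ φ : S → ℝ, (((t.groups.map fun h => (h.pend : Multiset (S → ℝ))).sum).map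
                  fun w => φ ⬝ᵥ w).prod ^ 2 * (weight A φ * source f φ))
              * (Kd t.dirs * Real.sqrt (∫ φ : S → ℝ, Sh.indicator (fun _ => (1 : ℝ)) φ * (weight A φ * source f φ))))
      ∧ Multiset.card t.groups
          ≤ Multiset.card (t.groups.filter fun g => 0 < g.nchi) + Multiset.card (t.groups.filter fun g => M ≤ g.nv) := by
  intro t ht
  obtain ⟨-, hchi, -, hcard⟩ := remainder_components_count (A := A) (f := f) (c := c) (legs := legs) (obs := obs)
    (M := M) K t ht
  refine ⟨?_, fun hpos => abs_gintM_le_shell A f c legs hA hχ hK hSh hχS _ (dirs_ne_nil_of_card_pos hchi hpos), hcard⟩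
  rw [tval, List.nil_append, abs_mul]
  exact mul_le_mul_of_nonneg_right (expand_coef_bound_sat hB hBf hcM hcM1 hcm hobs hlegs K t ht) (abs_nonneg _)

end Expand

end Literature.MathematicalPhysics.QuantumFieldTheory.BalabanImbrieJaffe1984to88.BIJ88LabelledCoefBound312

end
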